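import Summits.RiemannHypothesis.RiemannHypothesis.Theorems.WeilFormatCDataO91ColTables
import HarnessLib

/-!
# Format C kernel rung `O91` (a = 91/100, column-band layout): light-table slices 880…940 (kernel certificates)

Window `a = 91/100`; prime powers in the window: 2, 3, 2^2, 5; prime constant A = 1825/1000 (`WeilFormatC.primeCoeff_form_ge_cells_09729`); evaluator parameters S = 2^256, Kpi 130, Kser 150, kred 8, Kexp 45, J 120; full table modes < 161; light column table modes < 1027; units 2^-250 (Schur entries), 2^-124 (column digits, width 127), 2^-118 (tail-factor digits, width 121), 2^-64 (reciprocal weights), 2^-40 (tail base); order-J tail J = 4, θ = 1/2048, η = 1/10 | 4/1.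
Design row: sr-gb-rung-a odd λ-run (parity cell 9 L-side): a = 91/100, μ = 2·LAMZ·2^-250 (LAMZ=7662477704329444291791735135751545918093695610918010880), odd 160/320/1024, MS tail; see HOME(A)/LADDER-LSIDES-FORMATC-A-g22.md. Generated by sr-gb-rung-a prover A g22 with rh-explicit-weil-2 gen7's generator extended for the odd λ-run (--sector odd --mu-log2; HOME(A)/code-g22/gen7/gramgen7.py sha16 0aa3348087f4e84e) from `#eval` of the tree's `Encl` functions; every datum is re-verified by the kernel in the theorem files (`decide +kernel`). Helper data of the rh-explicit Weil-positivity programme (format C, K-CELL-2), RH-free. [cite: Yoshida1992HermitianForms, §5 (5.15)-(5.16) p. 301; §7 pp. 305–312]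
-/

set_option linter.dupNamespace false
set_option maxRecDepth 200000

namespace Summit.RiemannHypothesis.RiemannHypothesis.Theorems.WeilFormatCData.O91
open Literature.NumberTheory.LFunctions Literature.NumberTheory.LFunctions.Yoshida1992 Encl Literature.Analysis.ValidatedNumerics.NumericsMP

/-- kernel: light-table slice `[880, 890)`. -/
theorem tC880 : checkTableCol O91.prm O91.C O91.ctab 880 10 = true := by decide +kernel

/-- kernel: light-table slice `[890, 900)`. -/
theorem tC890 : checkTableCol O91.prm O91.C O91.ctab 890 10 = true := by decide +kernel

/-- kernel: light-table slice `[900, 910)`. -/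
theorem tC900 : checkTableCol O91.prm O91.C O91.ctab 900 10 = true := by decide +kernel

/-- kernel: light-table slice `[910, 920)`. -/
theorem tC910 : checkTableCol O91.prm O91.C O91.ctab 910 10 = true := by decide +kernel

/-- kernel: light-table slice `[920, 930)`. -/
theorem tC920 : checkTableCol O91.prm O91.C O91.ctab 920 10 = true := by decide +kernel

/-- kernel: light-table slice `[930, 940)`. -/
theorem tC930 : checkTableCol O91.prm O91.C O91.ctab 930 10 = true := by decide +kernel

end Summit.RiemannHypothesis.RiemannHypothesis.Theorems.WeilFormatCData.O91
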